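import Summits.QuantumFields.BalabanUV.Beta.FP.TorusCompositeCovariance
import Summits.QuantumFields.BalabanUV.Beta.FP.NestedStepLawTransportedDeadRows

/-!
# `BalabanUV.Beta.FP.TorusCompositeSlice` — road «FP» for binder row D1, ROUTE T, the OWNER's SPEC-27 «THE (j, m) TORUS CALL FOR m ≥ 2»,
# (SLICE-m) part 3a: **THE NESTED COMB SLICE OF THE TOWER IS A NON-DEGENERATE GAUGE FIXING AT EVERY DEPTH — `hTW^{(n)}`** (the tower twin of
# `NestedStepLawOneShotLetters.det_nestedSlice_mul_gauge_ne_zero`), **and the coarse dead rows `t1 ∕ t2` of the composite call from leaf-02's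
# (COV-m) letters** (the tower twins of `NestedStepLawTransportedDeadRows.torus_t1_of_c1 ∕ torus_t2_of_c2`)

WHAT.  Objects of `FP/TorusCompositeObjects` (leaf-06 g20): the nested comb slice `nestedSlice Lc M lev rs n` of the `n+1`-level tower below `M`
(`nestedSlice_succ`: the top comb `combF Lc M (rs 0)` composed with the full composite averaging `compRows … (n+1)`, STACKED over the nested slice of the
tower below `fine Lc M`) and the tower generator matrix `towerGen Lc M rs n` (`towerGen_succ`: the top level's block-constant modes LEFT of the lower tower's
generators).  §1: **`det (nestedSlice Lc M lev rs n * towerGen Lc M rs n) ≠ 0` for every depth `n`, every top torus `M` with `Lc ∣ M i`, every level sequence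
`lev` and in-block roots `rs k ∈ box Lc`** — by induction on the depth with the top torus varying: by leaf-02 g21's (COV-m) ORDER 0
`TorusCompositeCovariance.compRows_mul_towerGen_succ` (`compRows … (n+1) · towerGen … (n+1) = [σ_{n+1} • D̄ | 0]`) the pairing is BLOCK LOWER-TRIANGULAR,
`fromBlocks (σ_{n+1} • combF · D̄) 0 (∗) (nestedSlice (fine Lc M) … n · towerGen (fine Lc M) … n)` (`Matrix.fromRows_mul ∕ mul_fromCols ∕ fromRows_fromCols_eq_fromBlocks`),
so `det = σ_{n+1}^{|Res|} · det (combF · D̄) · det (lower)` (`Matrix.det_fromBlocks_zero₁₂`, `Matrix.det_smul`) with `|det (combF · D̄)| = 1` at EVERY torus with `Lc ∣ M i`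
(`TorusCombRows.abs_det_combRowsT_mul_tgrad_eq_one_of_box` — `NestedStepLawTorusInstance.torus_uni₁`'s argument with the torus a parameter), `σ_{n+1} ≠ 0`
(`stepScale_ne_zero`, `#B ≠ 0`), and the lower factor the induction hypothesis at `fine Lc M` (`Lc ∣ fine Lc M i` always).  This is the OWNER d1-p3's composite call
`FP/NestedStepLawTorusComposite` (#15, p329391 ∕ v1.1 p329632) binder `hTW : (fromRows (τ₂ * Q₁₀) τ₁ * W₀).det ≠ 0` at `hτ₂ : τ₂ = combF Lc M′ (rs 0)`,
`hQ₁₀ : Q₁₀ = compRows Lc M′ lev rs (n+1)`, `hτ₁ : τ₁ = nestedSlice Lc (fine Lc M′) (lev ∘ succ) (rs ∘ succ) n`, `hW₀ : W₀ = towerGen Lc M′ rs (n+1)` BY TERM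
(`det_fromRows_combF_compRows_nestedSlice_mul_towerGen_ne_zero`: `fromRows (combF · compRows (n+1)) (nestedSlice (fine) n)` IS `nestedSlice … (n+1)` by
`nestedSlice_succ`, `rfl`).  §2: the coarse dead rows of the composite call from leaf-02's displayed (COV-m) letters `c1 : Q₁₁ * W₀ + Q₁₀ * W₁ = fromCols D̄₁ 0`,
`c2 : Q₁₂ * W₀ + 2 • (Q₁₁ * W₁) + Q₁₀ * W₂ = fromCols D̄₂ 0` and coarse jets `D̄₁ D̄₂` DEAD ON THE TOP COMB (`IsCombBondAt (toSite (rs 0)) Lc` on `M′`, displayed):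
`t1 : τ₂ * (Q₁₁ * W₀ + Q₁₀ * W₁) = 0`, `t2 : …` at `hτ₂ : τ₂ = combF Lc M′ (rs 0)` — my g18 `t_of_covariance_letter` + `torus_coarse_of_vanish_on_coarseComb`,
ANY depth, ANY `Q₁ₖ W₀ Wₖ` (the parameter type of the lower tower is free).  NOT HERE (part 3b, on the OWNER's word): the fine dead rows `s1 s2`
(`τ₁ * Wₖ = 0`) — at depth `0` they are g19's `TorusGeneratorIntertwiningTwo.torus_s1_of_dead ∕ torus_s2_of_dead` verbatim (`nestedSlice_zero = combF`); at
depth `≥ 1` see the located question F-d1leaf06g21-1 (journal).  [folklore] linear algebra over OUR tower objects; no `def`, no `def … : Prop`, nothing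
cited, 0 sorry.  Nothing of the dictionary ∕ Bałaban's asserted.

HONEST DEPENDENCY (page 1, mandatory): continuum YM on T⁴ ⇐ BetaPertH ∧ nine spine estimates (0/9 proved); BetaPertH ⇐ (D1) ∧ (D4) ∧ CAP+tail;
G-an2-4 gates asym, D1 and NE2/3/4.  HONEST FRAMING (cell contract, verbatim): «discharging `BetaPertH` makes Bałaban's UV stability UNCONDITIONAL —
a real constructive-QFT result; it is NOT the continuum limit and NOT the Clay problem.»  ABSOLUTE RULE (cell charter, verbatim): «No internally-minted
statement may enter as a cited fact. Every hypothesis is either kernel-proved in this package or a verbatim quotation of a PUBLISHED theorem with page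
reference. The manuscript(s) under audit are NOT citable for their own disputed steps — they are the thing under adjudication; programme-internal
(2001/route/tribunal) claims are never citable.»  0 estimates; 0∕4 row-D1 binders; NOT (T-ID), NOT SDF, NOT D1, NOT BetaPertH, NOT continuum, NOT Clay.
D1 formalisation swarm LEAF PROVER 06 (b2b-balaban-beta-d1-formalise-leaf-06 gen 21), 2026-08-22.  No existing file touched.
-/

noncomputable section

open scoped BigOperators

namespace Summit.QuantumFields.BalabanUV.Beta.FP.TorusCompositeSlice

open Matrix Finset
open Literature.MathematicalPhysics.QuantumFieldTheory.Balaban1983to89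
open Literature.MathematicalPhysics.QuantumFieldTheory.Balaban1983to89.Beta
open B5Prop11Plancherel (fine)
open B6Lemma24Torus (pbox)
open AffineAveraging (Site box toSite)
open OneStepResolventKernel (Fib)
open Summit.QuantumFields.BalabanUV.Beta.BorderedHessian (stepScale stepScale_ne_zero)
open Summit.QuantumFields.BalabanUV.Beta.AxialDressingRooted (IsCombBondAt)
open Summit.QuantumFields.BalabanUV.Beta.FP.KernelPeriodisationFib (Idx)
open Summit.QuantumFields.BalabanUV.Beta.FP.TorusGaugeCovariance (tgrad tgrad_inr)
open Summit.QuantumFields.BalabanUV.Beta.FP.TorusGaugeCovarianceCoarse (tgradBlock)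
open Summit.QuantumFields.BalabanUV.Beta.FP.TorusCombRows (Res combRowsT abs_det_combRowsT_mul_tgrad_eq_one_of_box)
open Summit.QuantumFields.BalabanUV.Beta.FP.NestedStepLawOneShotLetters (det_ne_zero_of_abs_det det_nestedSlice_mul_gauge_ne_zero)
open Summit.QuantumFields.BalabanUV.Beta.FP.NestedStepLawTorusInstance (submatrix_field_mul submatrix_id_mul dvd_fine)
open Summit.QuantumFields.BalabanUV.Beta.FP.NestedStepLawTransportedDeadRows (t_of_covariance_letter torus_coarse_of_vanish_on_coarseComb)
open Summit.QuantumFields.BalabanUV.Beta.FP.TorusCompositeObjects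
open Summit.QuantumFields.BalabanUV.Beta.FP.TorusCompositeCovariance (compRows_mul_towerGen_succ)

variable {d : ℕ}

/-! ## §1 `hTW^{(n)}`: the nested comb slice against the tower generators is non-degenerate at every depth -/

section NestedPairing

variable (Lc : ℕ) [NeZero Lc]

/-- [folklore] **`|det (combF · D̄)| = 1` AT EVERY TORUS WITH `Lc ∣ M i`** (`NestedStepLawTorusInstance.torus_uni₁ ∕ torus_uni₂`'s (UNI) letter with the torus a
parameter): the comb rows of `M` against its gauge modes at the comb's residual parameters, read on the field slots. -/
theorem abs_det_combF_mul_tgrad_res_eq_one (M : Fin (d + 1) → ℕ) [∀ μ, NeZero (M μ)] {r : Fin (d + 1) → ℕ} (hr : r ∈ box (d + 1) Lc)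
    (hM : ∀ i, Lc ∣ M i) :
    |(combF Lc M r * (tgrad M).submatrix (fun a : ↥(pbox M) × Fin (d + 1) => ((a.1, Sum.inl a.2) : Idx M (Fib d)))
        (fun t : Res (toSite r) Lc M => (t.1 : ↥(pbox M)))).det| = 1 := by
  rw [combF, submatrix_field_mul M _ _ (tgrad_inr M), submatrix_id_mul]
  exact abs_det_combRowsT_mul_tgrad_eq_one_of_box hr (Nat.pos_of_ne_zero (NeZero.ne Lc)) hM

/-- [folklore] the composite normalisation `σ_{n+1} = ∏_{i<n+1} stepScale d Lc (lev (i+1)) · #B` of leaf-02's (COV-m) ORDER 0 is non-zero. -/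
theorem prod_stepScale_mul_card_ne_zero (lev : ℕ → ℕ) (m : ℕ) :
    (∏ i ∈ range m, (stepScale d Lc (lev (i + 1)) * ((box (d + 1) Lc).card : ℝ))) ≠ 0 := by
  refine prod_ne_zero_iff.mpr fun i _ => mul_ne_zero (stepScale_ne_zero _) ?_
  have h0 : (0 : Fin (d + 1) → ℕ) ∈ box (d + 1) Lc := by
    simp only [AffineAveraging.box, Fintype.mem_piFinset, Finset.mem_range]
    exact fun _ => Nat.pos_of_ne_zero (NeZero.ne Lc)
  exact_mod_cast (Finset.card_pos.mpr ⟨0, h0⟩).ne'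

/-- [folklore] **THE TOP BLOCK**: `det (combF Lc M (rs 0) · (σ • D̄)) ≠ 0` (`σ ≠ 0`, `|det (combF · D̄)| = 1`). -/
theorem det_combF_mul_smul_tgrad_res_ne_zero (M : Fin (d + 1) → ℕ) [∀ μ, NeZero (M μ)] {r : Fin (d + 1) → ℕ} (hr : r ∈ box (d + 1) Lc)
    (hM : ∀ i, Lc ∣ M i) {σ : ℝ} (hσ : σ ≠ 0) :
    (combF Lc M r * (σ • (tgrad M).submatrix (fun a : ↥(pbox M) × Fin (d + 1) => ((a.1, Sum.inl a.2) : Idx M (Fib d)))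
        (fun t : Res (toSite r) Lc M => (t.1 : ↥(pbox M))))).det ≠ 0 := by
  rw [Matrix.mul_smul, Matrix.det_smul]
  exact mul_ne_zero (pow_ne_zero _ hσ) (det_ne_zero_of_abs_det (abs_det_combF_mul_tgrad_res_eq_one Lc M hr hM) one_ne_zero)

/-- [folklore] **`hTW^{(n)}` — THE NESTED COMB SLICE OF THE `n+1`-LEVEL TOWER AGAINST THE TOWER GENERATOR MATRIX IS NON-DEGENERATE AT EVERY DEPTH**:
`det (nestedSlice Lc M lev rs n * towerGen Lc M rs n) ≠ 0` for every top torus `M` with `Lc ∣ M i`, every level sequence and in-block roots.  Induction on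
the depth with the top torus varying: depth `0` = `|det (combF · D̄)| = 1`; the step is `NestedStepLawOneShotLetters.det_nestedSlice_mul_gauge_ne_zero` (the
depth-1 `hTW` lemma, generic) at `τ₁ := nestedSlice (fine Lc M) … n`, `τ₂ := combF Lc M (rs 0)`, `Q₁₀ := compRows … (n+1)`, `[D₂ | D₁] := towerGen … (n+1)`
(`towerGen_succ`), `D̄ := σ_{n+1} • tgrad M↾(fields × Res)`, its two covariance letters `Q₁₀ D₁ = 0`, `Q₁₀ D₂ = D̄` being the two blocks of leaf-02's
`compRows_mul_towerGen_succ` (read entrywise), `|det (τ₁ D₁)| ≠ 0` the induction hypothesis at `fine Lc M` and `|det (τ₂ D̄)| ≠ 0` the top block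
(`det_combF_mul_smul_tgrad_res_ne_zero`); `fromRows (τ₂ Q₁₀) τ₁ * fromCols D₂ D₁` IS `nestedSlice … (n+1) * towerGen … (n+1)` (`nestedSlice_succ ∕ towerGen_succ`, `rfl`). -/
theorem det_nestedSlice_mul_towerGen_ne_zero :
    ∀ (n : ℕ) (M : Fin (d + 1) → ℕ) [∀ μ, NeZero (M μ)] (lev : ℕ → ℕ) (rs : ℕ → (Fin (d + 1) → ℕ)),
      (∀ k, rs k ∈ box (d + 1) Lc) → (∀ i, Lc ∣ M i) → (nestedSlice Lc M lev rs n * towerGen Lc M rs n).det ≠ 0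
  | 0, M, _, lev, rs, hrs, hM =>
    det_ne_zero_of_abs_det (abs_det_combF_mul_tgrad_res_eq_one Lc M (hrs 0) hM) one_ne_zero
  | n + 1, M, _, lev, rs, hrs, hM => by
    have ih := det_nestedSlice_mul_towerGen_ne_zero n (fine Lc M) (fun k => lev (k + 1)) (fun k => rs (k + 1)) (fun k => hrs (k + 1)) (dvd_fine M)
    have htop := det_combF_mul_smul_tgrad_res_ne_zero Lc M (hrs 0) hM (prod_stepScale_mul_card_ne_zero (d := d) Lc lev (n + 1))
    -- leaf-02's c0-tower: `compRows … (n+1) · towerGen … (n+1) = [σ_{n+1} • D̄ | 0]`, read entrywise as the two covariance letters of the generic lemma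
    have c0 := compRows_mul_towerGen_succ Lc n M lev rs hrs
    exact det_nestedSlice_mul_gauge_ne_zero
      (nestedSlice Lc (fine Lc M) (fun k => lev (k + 1)) (fun k => rs (k + 1)) n) (combF Lc M (rs 0)) (compRows Lc M lev rs (n + 1))
      (towerGen Lc (fine Lc M) (fun k => rs (k + 1)) n)
      ((tgradBlock M (bigRatio Lc n)).submatrix
        (fun b : ↥(pbox (towerTorus Lc (fine Lc M) n)) × Fin (d + 1) =>
          ((pboxCongr (towerTorus_fine_eq_fine Lc M n) b.1, Sum.inl b.2) : Idx (fine (bigRatio Lc n) M) (Fib d)))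
        (Subtype.val : Res (toSite (rs 0)) Lc M → ↥(pbox M)))
      ((∏ i ∈ range (n + 1), (stepScale d Lc (lev (i + 1)) * ((box (d + 1) Lc).card : ℝ))) •
        (tgrad M).submatrix (fun a : ↥(pbox M) × Fin (d + 1) => ((a.1, Sum.inl a.2) : Idx M (Fib d)))
          (fun t : Res (toSite (rs 0)) Lc M => (t.1 : ↥(pbox M))))
      -- the two blocks of `c0`, entrywise: `towerGen … (n+1) j (inr y)` IS `towerGen (fine Lc M) … n j y`, `… (inl t)` IS `D_top j t` (`towerGen_succ`, `rfl`)
      (Matrix.ext fun a y => congrFun (congrFun c0 a) (Sum.inr y))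
      (Matrix.ext fun a t => congrFun (congrFun c0 a) (Sum.inl t))
      rfl rfl (abs_ne_zero.mpr ih) (abs_ne_zero.mpr htop)

/-- [folklore] **THE OWNER's `hTW` AT DEPTH `n+1`, IN THE CALL's SPELLING** (`FP/NestedStepLawTorusComposite` §2∕§3 after `rw [hτ₂, hQ₁₀, hτ₁, hW₀]`):
`det (fromRows (combF Lc M′ (rs 0) * compRows Lc M′ lev rs (n+1)) (nestedSlice Lc (fine Lc M′) (lev ∘ succ) (rs ∘ succ) n) * towerGen Lc M′ rs (n+1)) ≠ 0` —
the `fromRows` IS `nestedSlice Lc M′ lev rs (n+1)` (`nestedSlice_succ`, `rfl`). -/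
theorem det_fromRows_combF_compRows_nestedSlice_mul_towerGen_ne_zero (M' : Fin (d + 1) → ℕ) [∀ μ, NeZero (M' μ)] (lev : ℕ → ℕ)
    (rs : ℕ → (Fin (d + 1) → ℕ)) (hrs : ∀ k, rs k ∈ box (d + 1) Lc) (hM' : ∀ i, Lc ∣ M' i) (n : ℕ) :
    (Matrix.fromRows (combF Lc M' (rs 0) * compRows Lc M' lev rs (n + 1))
          (nestedSlice Lc (fine Lc M') (fun k => lev (k + 1)) (fun k => rs (k + 1)) n)
        * towerGen Lc M' rs (n + 1)).det ≠ 0 :=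
  det_nestedSlice_mul_towerGen_ne_zero Lc (n + 1) M' lev rs hrs hM'

/-- [folklore] **`hTW` OF THE COMPOSITE CALL, BINDERS VERBATIM** (`FP/NestedStepLawTorusComposite` §2∕§3: `τ₂ Q₁₀ τ₁` pinned by `hτ₂ hQ₁₀ hτ₁`, the generators by
§3's `hW₀`): `(fromRows (τ₂ * Q₁₀) τ₁ * W₀).det ≠ 0`. -/
theorem torus_hTW_tower (M' : Fin (d + 1) → ℕ) [∀ μ, NeZero (M' μ)] (lev : ℕ → ℕ) (rs : ℕ → (Fin (d + 1) → ℕ)) (n : ℕ)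
    (hrs : ∀ k, rs k ∈ box (d + 1) Lc) (hM' : ∀ i, Lc ∣ M' i)
    {Q₁₀ : Matrix (↥(pbox M') × Fin (d + 1)) (↥(pbox (towerTorus Lc M' (n + 1))) × Fin (d + 1)) ℝ}
    {τ₁ : Matrix (NParam Lc (fine Lc M') (fun k => rs (k + 1)) n) (↥(pbox (towerTorus Lc M' (n + 1))) × Fin (d + 1)) ℝ}
    (hQ₁₀ : Q₁₀ = compRows Lc M' lev rs (n + 1))
    (hτ₁ : τ₁ = nestedSlice Lc (fine Lc M') (fun k => lev (k + 1)) (fun k => rs (k + 1)) n)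
    {τ₂ : Matrix (Res (toSite (rs 0)) Lc M') (↥(pbox M') × Fin (d + 1)) ℝ} (hτ₂ : τ₂ = combF Lc M' (rs 0))
    {W₀ : Matrix (↥(pbox (towerTorus Lc M' (n + 1))) × Fin (d + 1)) (NParam Lc M' rs (n + 1)) ℝ} (hW₀ : W₀ = towerGen Lc M' rs (n + 1)) :
    (Matrix.fromRows (τ₂ * Q₁₀) τ₁ * W₀).det ≠ 0 := by
  subst hQ₁₀ hτ₁ hτ₂ hW₀
  exact det_nestedSlice_mul_towerGen_ne_zero Lc (n + 1) M' lev rs hrs hM'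

end NestedPairing

/-! ## §2 The coarse dead rows `t1 ∕ t2` of the composite call from leaf-02's (COV-m) letters -/

section CoarseDead

variable (M' : Fin (d + 1) → ℕ) (Lc : ℕ) [NeZero Lc] {r' : Fin (d + 1) → ℕ}

/-- [folklore] **`t1` OF THE COMPOSITE CALL AT EVERY DEPTH** (`FP/NestedStepLawTorusComposite`'s binder, `hτ₂ : τ₂ = combF Lc M′ (rs 0)` VERBATIM; ANY `Q₁₀ Q₁₁ W₀ W₁`,
any lower parameter type `Y`): from leaf-02's composite covariance letter `c1 : Q₁₁ * W₀ + Q₁₀ * W₁ = fromCols D̄₁ 0` and a coarse jet `D̄₁` vanishing at every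
TOP-comb slot (`IsCombBondAt (toSite r′) Lc` on `M′`; `Lc ∣ M′ i`), `τ₂ * (Q₁₁ * W₀ + Q₁₀ * W₁) = 0` — `t_of_covariance_letter` +
`torus_coarse_of_vanish_on_coarseComb` (`combF` unfolds to the `hτ₂` of record by `rfl`). -/
theorem torus_t1_tower_of_c1 (hr' : r' ∈ box (d + 1) Lc) (hM' : ∀ i, Lc ∣ M' i)
    {τ₂ : Matrix (Res (toSite r') Lc M') (↥(pbox M') × Fin (d + 1)) ℝ} (hτ₂ : τ₂ = combF Lc M' r')
    {ν Y : Type*} [Fintype ν] (Q₁₀ Q₁₁ : Matrix (↥(pbox M') × Fin (d + 1)) ν ℝ) (W₀ W₁ : Matrix ν (Res (toSite r') Lc M' ⊕ Y) ℝ)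
    (Db₁ : Matrix (↥(pbox M') × Fin (d + 1)) (Res (toSite r') Lc M') ℝ)
    (c1 : Q₁₁ * W₀ + Q₁₀ * W₁ = fromCols Db₁ (0 : Matrix (↥(pbox M') × Fin (d + 1)) Y ℝ))
    (hDb₁ : ∀ a : ↥(pbox M') × Fin (d + 1), IsCombBondAt (toSite r') Lc a.2 (a.1 : Site (d + 1)) → Db₁ a = 0) :
    τ₂ * (Q₁₁ * W₀ + Q₁₀ * W₁) = 0 :=
  t_of_covariance_letter τ₂ _ Db₁ c1
    (torus_coarse_of_vanish_on_coarseComb M' (Nat.pos_of_ne_zero (NeZero.ne Lc)) hr' hM' (by rw [hτ₂]; rfl) Db₁ hDb₁)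

/-- [folklore] **`t2` OF THE COMPOSITE CALL AT EVERY DEPTH**: from `c2 : Q₁₂ * W₀ + 2 • (Q₁₁ * W₁) + Q₁₀ * W₂ = fromCols D̄₂ 0` and `D̄₂` vanishing at every
TOP-comb slot, `τ₂ * (Q₁₂ * W₀ + 2 • (Q₁₁ * W₁) + Q₁₀ * W₂) = 0`. -/
theorem torus_t2_tower_of_c2 (hr' : r' ∈ box (d + 1) Lc) (hM' : ∀ i, Lc ∣ M' i)
    {τ₂ : Matrix (Res (toSite r') Lc M') (↥(pbox M') × Fin (d + 1)) ℝ} (hτ₂ : τ₂ = combF Lc M' r')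
    {ν Y : Type*} [Fintype ν] (Q₁₀ Q₁₁ Q₁₂ : Matrix (↥(pbox M') × Fin (d + 1)) ν ℝ) (W₀ W₁ W₂ : Matrix ν (Res (toSite r') Lc M' ⊕ Y) ℝ)
    (Db₂ : Matrix (↥(pbox M') × Fin (d + 1)) (Res (toSite r') Lc M') ℝ)
    (c2 : Q₁₂ * W₀ + (2 : ℝ) • (Q₁₁ * W₁) + Q₁₀ * W₂ = fromCols Db₂ (0 : Matrix (↥(pbox M') × Fin (d + 1)) Y ℝ))
    (hDb₂ : ∀ a : ↥(pbox M') × Fin (d + 1), IsCombBondAt (toSite r') Lc a.2 (a.1 : Site (d + 1)) → Db₂ a = 0) :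
    τ₂ * (Q₁₂ * W₀ + (2 : ℝ) • (Q₁₁ * W₁) + Q₁₀ * W₂) = 0 :=
  t_of_covariance_letter τ₂ _ Db₂ c2
    (torus_coarse_of_vanish_on_coarseComb M' (Nat.pos_of_ne_zero (NeZero.ne Lc)) hr' hM' (by rw [hτ₂]; rfl) Db₂ hDb₂)

end CoarseDead

end Summit.QuantumFields.BalabanUV.Beta.FP.TorusCompositeSlice

end
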